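import Summits.ResolutionOfSingularities.ResolutionOfSingularities.Theorems.FrobeniusLadderFInjectiveMacaulayficationPolynomialAtOneDim
import Summits.ResolutionOfSingularities.ResolutionOfSingularities.Theorems.FrobeniusLadderFInjectiveMacaulayficationBlowupFiModelOfCover
import Mathlib.RingTheory.Localization.LocalizationLocalization
import Mathlib.RingTheory.Localization.Ideal
import Mathlib.RingTheory.Localization.Away.Basic
import HarnessLib

/-!
# Laurent descent from `A[X, X⁻¹]` at `(𝔫, X − 1)` to `A` at `𝔫`
# (crux `FInjectiveMacaulayfication`, line `graded-engine`, §16 helper H-G4b = G4 assembly step 4 packaging)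

Support file for crux stmt-ResolutionOfSingularities-15315 (`FrobeniusLadder.FInjectiveMacaulayfication`), §16 THE GRADED
ENGINE (CRUX-PLAN w45a v3, line `graded-engine`, registered stub G4 `stub_gradedChartClause`; design memo GRADED-ENGINE.md v2
step (v), lead seat res-L1-w45a-lead-1; `GradedChartClausePlan.lean` "G4 assembly" step 4). [OURS · L1 W4.5a] — bookkeeping
over landed route lemmas; not a statement of any manuscript; AI-written, weaker than expert review.

In the graded engine the Veronese subring `A' ≅ T₀[Y, Y⁻¹]` is presented as `Localization.Away (Y : T₀[Y])`, and finite
graded descent delivers the clause (every system of parameters weakly regular, every parameter ideal Frobenius closed) for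
`A'` at a maximal ideal `𝔐` lying over `𝔑 = 𝔫·T₀[Y] + (Y − 1)`. This file packages the way down to `(T₀)_𝔫`:

* `X_not_mem`, `disjoint_powers_X` — `X ∉ 𝔑 = 𝔫·A[X] + (X − 1)` (for `𝔫 ≠ ⊤`), so `𝔑` survives in `A[X, X⁻¹]`;
* `isPrime_map_away`, `comap_map_away`, `isMaximal_map_away`, `algebraMap_mem_iff_of_comap_eq` — the ideal
  `𝔐 = 𝔑·A[X, X⁻¹]` is a maximal ideal of `A[X, X⁻¹] = Localization.Away X` contracting to `𝔑`, with the expected membership test;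
* `laurentDescentAway` — **for a Noetherian ring `A` of characteristic `p`, a maximal ideal `𝔫`, and any prime `𝔐` of
  `A[X, X⁻¹]` contracting to `𝔑`: if `A[X, X⁻¹]_𝔐` satisfies the clause then so does `A_𝔫`** — because
  `A[X, X⁻¹]_𝔐 ≅ A[X]_𝔑` (Mathlib `IsLocalization.localizationLocalizationAtPrimeIsoLocalization`), `dim A[X]_𝔑 = dim A_𝔫 + 1`
  (`PolynomialAtOneDim.ringKrullDim_atPrime_eq_add_one`, p477508) and `LaurentDescent.laurentDescent` (p470480).

## References

* folklore (Laurent polynomial bookkeeping); H. Matsumura, *Commutative Ring Theory*, Thm. 15.1. [Matsumura1987]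
-/

set_option linter.dupNamespace false

noncomputable section

open Polynomial

namespace Summit.ResolutionOfSingularities.ResolutionOfSingularities.Theorems.FInjectiveMacaulayfication.LaurentDescentAway

variable {A : Type} [CommRing A]

/-- `X ∉ 𝔫·A[X] + (X − 1)` when `𝔫 ≠ ⊤` (else `1 = X − (X − 1)` would lie in it, i.e. `1 ∈ 𝔫` after evaluating at `1`).
[folklore] -/
theorem X_not_mem (𝔫 : Ideal A) (h𝔫 : 𝔫 ≠ ⊤) :
    (X : A[X]) ∉ 𝔫.map (Polynomial.C : A →+* A[X]) ⊔ Ideal.span {(X - 1 : A[X])} := by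
  rw [← LaurentDescent.comap_evalRingHom_one, Ideal.mem_comap, Polynomial.coe_evalRingHom, eval_X]
  exact fun h => h𝔫 ((Ideal.eq_top_iff_one 𝔫).mpr h)

/-- The powers of `X` are disjoint from `𝔫·A[X] + (X − 1)` when `𝔫` is prime. [folklore] -/
theorem disjoint_powers_X (𝔫 : Ideal A) [𝔫.IsPrime] (𝔑 : Ideal A[X])
    (h𝔑 : 𝔑 = 𝔫.map (Polynomial.C : A →+* A[X]) ⊔ Ideal.span {(X - 1 : A[X])}) :
    Disjoint ((Submonoid.powers (X : A[X]) : Set A[X])) (𝔑 : Set A[X]) := by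
  haveI : 𝔑.IsPrime := by
    rw [h𝔑, ← LaurentDescent.comap_evalRingHom_one]
    infer_instance
  rw [Set.disjoint_left]
  rintro _ ⟨m, rfl⟩ hm
  exact X_not_mem 𝔫 (Ideal.IsPrime.ne_top inferInstance) (h𝔑 ▸ Ideal.IsPrime.mem_of_pow_mem inferInstance m hm)

/-- `𝔐 = 𝔑·A[X, X⁻¹]` is a prime of `A[X, X⁻¹] = Localization.Away X` for `𝔑 = 𝔫·A[X] + (X − 1)`, `𝔫` prime. [folklore] -/
theorem isPrime_map_away (𝔫 : Ideal A) [𝔫.IsPrime] (𝔑 : Ideal A[X])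
    (h𝔑 : 𝔑 = 𝔫.map (Polynomial.C : A →+* A[X]) ⊔ Ideal.span {(X - 1 : A[X])}) :
    (𝔑.map (algebraMap A[X] (Localization.Away (X : A[X])))).IsPrime := by
  haveI : 𝔑.IsPrime := by
    rw [h𝔑, ← LaurentDescent.comap_evalRingHom_one]
    infer_instance
  exact IsLocalization.isPrime_of_isPrime_disjoint (Submonoid.powers (X : A[X])) _ 𝔑 inferInstance
    (disjoint_powers_X 𝔫 𝔑 h𝔑)

/-- `𝔑·A[X, X⁻¹]` contracts to `𝔑`. [folklore] -/
theorem comap_map_away (𝔫 : Ideal A) [𝔫.IsPrime] (𝔑 : Ideal A[X])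
    (h𝔑 : 𝔑 = 𝔫.map (Polynomial.C : A →+* A[X]) ⊔ Ideal.span {(X - 1 : A[X])}) :
    (𝔑.map (algebraMap A[X] (Localization.Away (X : A[X])))).comap
      (algebraMap A[X] (Localization.Away (X : A[X]))) = 𝔑 := by
  haveI : 𝔑.IsPrime := by
    rw [h𝔑, ← LaurentDescent.comap_evalRingHom_one]
    infer_instance
  exact IsLocalization.under_map_of_isPrime_disjoint (Submonoid.powers (X : A[X])) _ inferInstance
    (disjoint_powers_X 𝔫 𝔑 h𝔑)

/-- `𝔑·A[X, X⁻¹]` is a maximal ideal of `A[X, X⁻¹]` when `𝔫` is maximal. [folklore] -/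
theorem isMaximal_map_away (𝔫 : Ideal A) [𝔫.IsMaximal] (𝔑 : Ideal A[X])
    (h𝔑 : 𝔑 = 𝔫.map (Polynomial.C : A →+* A[X]) ⊔ Ideal.span {(X - 1 : A[X])}) :
    (𝔑.map (algebraMap A[X] (Localization.Away (X : A[X])))).IsMaximal := by
  haveI : 𝔑.IsMaximal := PolynomialAtOneDim.isMaximal_of_eq 𝔫 𝔑 h𝔑
  haveI : ((𝔑.map (algebraMap A[X] (Localization.Away (X : A[X])))).under A[X]).IsMaximal := by
    rw [Ideal.under_def, comap_map_away 𝔫 𝔑 h𝔑]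
    infer_instance
  exact Ideal.IsMaximal.of_isLocalization_of_disjoint (Submonoid.powers (X : A[X]))

/-- Membership test in a prime `𝔐` of `A[X, X⁻¹]` contracting to `𝔑`: `g/1 ∈ 𝔐 ↔ g ∈ 𝔑`. [folklore] -/
theorem algebraMap_mem_iff_of_comap_eq (𝔑 : Ideal A[X]) (𝔐 : Ideal (Localization.Away (X : A[X])))
    (h𝔐 : 𝔐.comap (algebraMap A[X] (Localization.Away (X : A[X]))) = 𝔑) (g : A[X]) :
    algebraMap A[X] (Localization.Away (X : A[X])) g ∈ 𝔐 ↔ g ∈ 𝔑 := by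
  rw [← h𝔐, Ideal.mem_comap]

/-- **LAURENT DESCENT, `Localization.Away` form.** `A` a Noetherian ring of characteristic `p`, `𝔫` a maximal ideal, `𝔐` a prime
of `A[X, X⁻¹] = Localization.Away (X : A[X])` contracting to `𝔑 = 𝔫·A[X] + (X − 1)` (e.g. `𝔐 = 𝔑·A[X, X⁻¹]`,
`comap_map_away`). If `A[X, X⁻¹]_𝔐` satisfies the clause — every system of parameters weakly regular, every parameter ideal
Frobenius closed — then so does `A_𝔫`: `A[X, X⁻¹]_𝔐 ≅ A[X]_𝔑`, `dim A[X]_𝔑 = dim A_𝔫 + 1`, and `LaurentDescent.laurentDescent`.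
[folklore] -/
theorem laurentDescentAway (p : ℕ) [Fact p.Prime] (A : Type) [CommRing A] [IsNoetherianRing A] [CharP A p]
    (𝔫 : Ideal A) [𝔫.IsMaximal] (𝔐 : Ideal (Localization.Away (X : A[X]))) [𝔐.IsPrime]
    (h𝔐 : 𝔐.comap (algebraMap A[X] (Localization.Away (X : A[X]))) =
      𝔫.map (Polynomial.C : A →+* A[X]) ⊔ Ideal.span {(X - 1 : A[X])})
    (hD : ∀ d : ℕ, ringKrullDim (Localization.AtPrime 𝔐) = d → ∀ s : Fin d → Localization.AtPrime 𝔐,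
      (Ideal.span (Set.range s)).radical.IsMaximal →
        RingTheory.Sequence.IsWeaklyRegular (Localization.AtPrime 𝔐) (List.ofFn s) ∧
        ∀ y : Localization.AtPrime 𝔐, (∃ e : ℕ, y ^ p ^ e ∈ Ideal.span
          ((fun z : Localization.AtPrime 𝔐 => z ^ p ^ e) ''
            (Ideal.span (Set.range s) : Set (Localization.AtPrime 𝔐)))) → y ∈ Ideal.span (Set.range s)) :
    ∀ d : ℕ, ringKrullDim (Localization.AtPrime 𝔫) = d → ∀ s : Fin d → Localization.AtPrime 𝔫,
      (Ideal.span (Set.range s)).radical.IsMaximal →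
        RingTheory.Sequence.IsWeaklyRegular (Localization.AtPrime 𝔫) (List.ofFn s) ∧
        ∀ y : Localization.AtPrime 𝔫, (∃ e : ℕ, y ^ p ^ e ∈ Ideal.span
          ((fun z : Localization.AtPrime 𝔫 => z ^ p ^ e) ''
            (Ideal.span (Set.range s) : Set (Localization.AtPrime 𝔫)))) → y ∈ Ideal.span (Set.range s) := by
  -- `𝔑 = 𝔫·A[X] + (X − 1)`, a maximal ideal of `A[X]`
  obtain ⟨𝔑, h𝔑⟩ : ∃ 𝔑 : Ideal A[X], 𝔑 = 𝔫.map (Polynomial.C : A →+* A[X]) ⊔ Ideal.span {(X - 1 : A[X])} :=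
    ⟨_, rfl⟩
  haveI : 𝔑.IsMaximal := PolynomialAtOneDim.isMaximal_of_eq 𝔫 𝔑 h𝔑
  rw [← h𝔑] at h𝔐
  -- `A[X, X⁻¹]_𝔐 ≅ A[X]_{𝔐 ∩ A[X]} ≅ A[X]_𝔑`
  have e₁ : Localization.AtPrime (𝔐.comap (algebraMap A[X] (Localization.Away (X : A[X])))) ≃+*
      Localization.AtPrime 𝔐 :=
    (IsLocalization.localizationLocalizationAtPrimeIsoLocalization (Submonoid.powers (X : A[X])) 𝔐).toRingEquiv
  obtain ⟨e₂⟩ := BlowupFiModelOfCover.nonempty_ringEquiv_localization_of_ringEquiv (RingEquiv.refl A[X])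
    (𝔐.comap (algebraMap A[X] (Localization.Away (X : A[X])))) 𝔑 (fun x => by rw [← h𝔐]; rfl)
  have hD' := DegreeZeroDescent.inlineClause_of_ringEquiv p (e₁.symm.trans e₂) hD
  exact LaurentDescent.laurentDescent p A 𝔫 𝔑 h𝔑 (PolynomialAtOneDim.ringKrullDim_atPrime_eq_add_one 𝔫 𝔑 h𝔑) hD'

end Summit.ResolutionOfSingularities.ResolutionOfSingularities.Theorems.FInjectiveMacaulayfication.LaurentDescentAway

end
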